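/-
Copyright (c) 2026 the pub-hodgecm-mathlib formalisation cell (harness21).  Prover seat hodgecm-mathlib-F0P3a-p04 (g16), 2026-09-01.  Road «S3-tree» (architect A-p16 (g29) A-67 (3)),
brick T3′ «depth-zero κ-transfer» (holder F0P3b-p01 (g11)), population (P-2) TYPE (2): organ O8d-2u «THE UNIT ROW, TYPE (2)» — the `hK` row of ★ O8d-2s
`DepthZeroKappaTransferTypeTwoSocket` (p846003) from the ★ unit values of the closed line «N7nsCount».
-/
import Literature.NumberTheory.Rogawski1990.UnitFundamentalLemmaInertIrredValuePos              -- ★ B-p12 p842319: `Φ(⟦δ⟧, 1_K) = phiTHn q n N` on the `κ = +1` class (brings the compactness ★ p842297)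
import Literature.NumberTheory.Rogawski1990.UnitOrbitalIntegralInertValueTHprimeClosed          -- ★ B-p14 p842360 (+ ED. 2): `Φ(⟦δ⟧, 1_K) = phiTHprimen q n N` on the `κ = −1` class
import Literature.NumberTheory.Automorphic.UnitaryDepthZeroPieceOrbitalIntegral                 -- ★ A-p12 p845945 O8b FILE 3: `classOrbitalIntegral_eq_mul_strata_three_of_deep` (the strata currency of the socket)
import Literature.NumberTheory.Rogawski1990.UnitFundamentalLemmaInertFlickerAlgebraTypeTwo      -- ★ `Flicker1998.flicker_theorem18n` (`phiTHn − phiTHprimen = (−q)^n · phiHtwo`)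
import Literature.NumberTheory.Automorphic.OrbitalMeasureCanonicalExistsCM                     -- ★ `exists_isCanonical_cmDatum_local` (canonical families exist for any Haar `νG`)
import Literature.NumberTheory.Automorphic.LocalUnitaryGroupUnimodular                          -- ★ `isMulRightInvariant_cmDatum_local_three` (every Haar measure on `U(H′)(L⁺_v)` is right invariant)
import HarnessLib

/-!
# The UNIT ROW of the type-(2) socket: `Σ_r n₊(r) − Σ_r n₋(r) = (−q)^n · W₂(N)` from the ★ unit values `phiTHn`, `phiTHprimen` and Flicker's Theorem 18

Topic `NumberTheory/Rogawski1990`; namespace `Literature.NumberTheory.Rogawski1990`.  THEOREMS ONLY (no definition, no instance, no notation, no named fact, no `sorry`); kernel lane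
`--supports stmt-HodgeConjecture-24833`.  Cell `pub/hodgecm-mathlib`, crux H413; road «S3-tree», brick T3′ (holder F0P3b-p01 (g11); HEAD v4 clause `…_typeTwo`, DESIGN v2 §2 (P-2);
census `F0/P3a/F0P3a-p04/g16/CENSUS-T3prime-P2.F0P3a-p04g16.md`).  HONEST LABEL: HC_CM is proved only modulo the cell's 2 remaining named inputs (hLiu418, h413) until rung 0
closes; this file is an ASSEMBLY over ★ material and asserts nothing printed.

THE MATHEMATICS.  In the frame of the ★ type-(2) unit values (non-split `v ∤ 2` unramified in `L`, good reduction, `ν_G(K) = 1`, `γ_H = (g, u)` `G`-regular with integral `χ_{ι(γ_H)}`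
and `χ_g` IRREDUCIBLE over `L_w`, observable exponents `|χ_g(u)_w| = exp(−n)`, `|disc χ_g| = exp(−(2N+1))`), let `δ ∈ G′_v` match `γ_H` and be DEEP at `w` (`charpoly(δ_w) ≡ (X−1)³
mod 𝔪_w` — automatic near `1`, the socket consumer's `V`).  The Jordan STRATA COUNTS of the fixed hyperspecial vertices of `δ`,
`n_r(δ) := #{q ∈ Fix_δ(G′_v ⧸ K_v) : rank(red((q.out⁻¹ δ q.out)_w) − 1) = r}` (★ O8b's currency, VERBATIM the sets of ★ `classOrbitalIntegral_eq_mul_strata_three_of_deep`), add up to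
the orbital integral of the unit: ★ A-p12's strata formula with the constant piece `g = 1_{K_v}`, `c ≡ 1` gives `Φ(⟦δ⟧, 1_{K_v}) = ν(K_v)·(n₀ + n₁ + n₂) = n₀ + n₁ + n₂`, and the ★
values give `Φ(⟦δ⟧, 1_{K_v}) = phiTHn q n N` (`κ_v(γ_H, δ) = +1`, ★ p842319) resp. `phiTHprimen q n N` (`κ = −1`, ★ p842360).  Hence
  `n₀(δ₊) + n₁(δ₊) + n₂(δ₊) = phiTHn q n N`,  `n₀(δ₋) + n₁(δ₋) + n₂(δ₋) = phiTHprimen q n N`,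
and by ★ `flicker_theorem18n` (`n ≤ 2N+1`, `n` even or `n = 2N+1` — the law of ★ `exists_irredExponents_of_hint`) the UNIT ROW `hK` of the ★ type-(2) socket
(`finsum_finExplicitDelta_mul_classOrbitalIntegral_eq_of_irreducible_of_strata`, p846003) holds with `np := n(δ₊)`, `nm := n(δ₋)`:
  **`Σ_r n_r(δ₊) − Σ_r n_r(δ₋) = (−q)^n · phiHtwo q N`.**

MEASURE-FREE (ref5 R-53 binder flag honoured): the statements carry NO measure, family or normalisation binder — inside the proofs a normalised Haar measure
`νG := haarMeasure K_v` (`νG(K_v) = 1`, right invariant by ★ `isMulRightInvariant_cmDatum_local_three`) and a canonical family for it (★ `exists_isCanonical_cmDatum_local`) are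
instantiated on the Borel σ-algebras, so the socket consumer (letter `∀ νG`, no normalisation) feeds `hK` by name.

* §1 `tsupport_indicator_cmLocalIntegralLevel_subset`, `indicator_cmLocalIntegralLevel_conj` (the unit is a depth-zero piece with `c ≡ 1`), `exists_haar_normalised_isCanonical`
  (a normalised Haar measure with a canonical family, on the Borel σ-algebras).
* §2 **`sum_ncard_rankStrata_eq_phiTHn_of_finKappaAt_eq_one`**, **`sum_ncard_rankStrata_eq_phiTHprimen_of_finKappaAt_eq_neg_one`** (the two class totals).
* §3 **`sum_ncard_rankStrata_sub_eq_neg_pow_mul_phiHtwo`** (THE UNIT ROW).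

## References
* [Flicker1998UnitaryFL] Y. Z. Flicker, *Elementary proof of the fundamental lemma for a unitary group*, Canad. J. Math. 50 (1998), Props. 11, 16, 17 pp. 87–97; Thm. 18 p. 97.
* [Rogawski1990] J. D. Rogawski, *Automorphic Representations of Unitary Groups in Three Variables* (1990), §4.9 p. 54 (orbital integrals as lattice counts), Prop. 4.9.1 (b) p. 55.
* [Kottwitz1986] R. E. Kottwitz, *Base change for unit elements of Hecke algebras*, Compositio Math. 60 (1986), §3 (fixed cosets).
-/

set_option autoImplicit false

noncomputable section

open MeasureTheory Measure NumberField IsDedekindDomain Matrix Polynomial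
open scoped MatrixGroups WithZero ValuativeRel

namespace Literature.NumberTheory.Rogawski1990

open Literature.NumberTheory.Automorphic Literature.NumberTheory.Automorphic.UnitaryGroup
open Literature.NumberTheory.Automorphic.IntegralReduction
open Literature.NumberTheory.GaloisRepresentations Literature.NumberTheory.NumberFields

variable (L : Type) [Field L] [NumberField L] [IsCMField L] (H' : Matrix (Fin 3) (Fin 3) L)
  {v : HeightOneSpectrum (𝓞 ↥(maximalRealSubfield L))}

/-! ## §1 The unit `1_{K_v}` is a depth-zero piece with stratum values `c ≡ 1` -/

omit [IsCMField L] in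
/-- `tsupport 1_{K_v} ⊆ K_v` (`K_v` is clopen). [cite: Rogawski1990, §4.9 p. 54] -/
theorem tsupport_indicator_cmLocalIntegralLevel_subset [IsCMField L] :
    tsupport ((cmLocalIntegralLevel L 3 H' v : Set ((cmDatum L 3 H').Local v)).indicator fun _ => (1 : ℂ)) ⊆
      (cmLocalIntegralLevel L 3 H' v : Set ((cmDatum L 3 H').Local v)) := by
  have hcl : IsClosed (cmLocalIntegralLevel L 3 H' v : Set ((cmDatum L 3 H').Local v)) :=
    Subgroup.isClosed_of_isOpen _ (isCompact_isOpen_cmLocalIntegralLevel L 3 H' v).2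
  exact closure_minimal (Set.support_indicator_subset) hcl

/-- `1_{K_v}(u x u⁻¹) = 1_{K_v}(x)` for `u ∈ K_v`. [cite: Rogawski1990, §4.9 p. 54] -/
theorem indicator_cmLocalIntegralLevel_conj (u : (cmDatum L 3 H').Local v) (hu : u ∈ cmLocalIntegralLevel L 3 H' v) (x : (cmDatum L 3 H').Local v) :
    ((cmLocalIntegralLevel L 3 H' v : Set ((cmDatum L 3 H').Local v)).indicator (fun _ => (1 : ℂ))) (u * x * u⁻¹) =
      ((cmLocalIntegralLevel L 3 H' v : Set ((cmDatum L 3 H').Local v)).indicator (fun _ => (1 : ℂ))) x := by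
  by_cases hx : x ∈ (cmLocalIntegralLevel L 3 H' v : Set ((cmDatum L 3 H').Local v))
  · have hux : u * x * u⁻¹ ∈ (cmLocalIntegralLevel L 3 H' v : Set ((cmDatum L 3 H').Local v)) :=
      Subgroup.mul_mem _ (Subgroup.mul_mem _ hu hx) (Subgroup.inv_mem _ hu)
    rw [Set.indicator_of_mem hux, Set.indicator_of_mem hx]
  · have hux : u * x * u⁻¹ ∉ (cmLocalIntegralLevel L 3 H' v : Set ((cmDatum L 3 H').Local v)) := by
      intro h
      apply hx
      have h1 : u⁻¹ * (u * x * u⁻¹) * u ∈ cmLocalIntegralLevel L 3 H' v :=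
        Subgroup.mul_mem _ (Subgroup.mul_mem _ (Subgroup.inv_mem _ hu) h) hu
      simpa [mul_assoc] using h1
    rw [Set.indicator_of_notMem hux, Set.indicator_of_notMem hx]


/-- **A NORMALISED HAAR MEASURE WITH A CANONICAL FAMILY** on `G′_v = U(H′)(L⁺_v)` (Borel σ-algebras supplied by the caller): `νG := haarMeasure K_v` has `νG(K_v) = 1`, is right
invariant (★ `isMulRightInvariant_cmDatum_local_three`), and carries a canonical orbital-measure family for the regular classes (★ `exists_isCanonical_cmDatum_local`).
[cite: Rogawski1990, §4.3 (4.3.1) p. 43; §4.9 p. 54] -/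
theorem exists_haar_normalised_isCanonical (hH' : (H'.map (IsCMField.complexConj L))ᵀ = H') (hH'u : IsUnit H')
    [MeasurableSpace ((cmDatum L 3 H').Local v)] [BorelSpace ((cmDatum L 3 H').Local v)]
    [∀ γ : ((cmDatum L 3 H').Local v), MeasurableSpace (((cmDatum L 3 H').Local v) ⧸ Subgroup.centralizer ({γ} : Set ((cmDatum L 3 H').Local v)))]
    [∀ γ : ((cmDatum L 3 H').Local v), BorelSpace (((cmDatum L 3 H').Local v) ⧸ Subgroup.centralizer ({γ} : Set ((cmDatum L 3 H').Local v)))] :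
    ∃ νG : Measure ((cmDatum L 3 H').Local v), ∃ _ : νG.IsHaarMeasure, ∃ _ : νG.IsMulRightInvariant,
      νG (cmLocalIntegralLevel L 3 H' v : Set ((cmDatum L 3 H').Local v)) = 1 ∧
        ∃ mG : OrbitalMeasureFamily ((cmDatum L 3 H').Local v),
          mG.IsCanonical (fun γ => IsRegularElt (γ.val : GL (Fin 3) (UnitaryGroup.LocalRing L v))) νG := by
  have hH'c : (H'.map (cmConjRingHom L))ᵀ = H' := by
    have e1 : H'.map (cmConjRingHom L) = H'.map (IsCMField.complexConj L) := by
      ext i j; simp [Matrix.map_apply, cmConjRingHom_apply]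
    rw [e1]; exact hH'
  have hdetu : IsUnit H'.det := (Matrix.isUnit_iff_isUnit_det _).1 hH'u
  have hdet : H'.det ≠ 0 := hdetu.ne_zero
  obtain ⟨hKc, hKo⟩ := isCompact_isOpen_cmLocalIntegralLevel L 3 H' v
  let K₀ : TopologicalSpace.PositiveCompacts ((cmDatum L 3 H').Local v) :=
    ⟨⟨(cmLocalIntegralLevel L 3 H' v : Set ((cmDatum L 3 H').Local v)), hKc⟩, by
      rw [hKo.interior_eq]; exact ⟨1, Subgroup.one_mem _⟩⟩
  refine ⟨Measure.haarMeasure K₀, inferInstance, isMulRightInvariant_cmDatum_local_three L H' hH'c hdet v _, Measure.haarMeasure_self, ?_⟩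
  haveI : (Measure.haarMeasure K₀).IsMulRightInvariant := isMulRightInvariant_cmDatum_local_three L H' hH'c hdet v _
  exact exists_isCanonical_cmDatum_local L H' hH' hdetu v (Measure.haarMeasure K₀)

/-! ## §2 The two class totals: `Σ_r n_r(δ) = phiTHn` (`κ = +1`) and `= phiTHprimen` (`κ = −1`) -/

set_option maxHeartbeats 400000 in
-- the strata sets are large terms (same budget as ★ p845914)
open scoped Classical in
/-- **THE `κ = +1` CLASS TOTAL**: for a deep match `δ` of a `G`-regular type-(2) `γ_H` with `κ_v(γ_H, δ) = +1`, the three Jordan-strata counts of its fixed hyperspecial vertices add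
up to `phiTHn q n N` (★ p842319 ∘ ★ A-p12's strata formula at `g = 1_{K_v}`, `c ≡ 1`, `ν(K_v) = 1`). [cite: Flicker1998UnitaryFL, Prop. 11 p. 87; Thm. 18 p. 97]
[cite: Rogawski1990, §4.9 p. 54, Prop. 4.9.1 (b) p. 55] [cite: Kottwitz1986, §3] -/
theorem sum_ncard_rankStrata_eq_phiTHn_of_finKappaAt_eq_one
    (hH' : (H'.map (IsCMField.complexConj L))ᵀ = H') (w : PlacesOver L v)
    (hw : IsCMField.complexConj L • w.1 = w.1) (hv : Algebra.IsUnramifiedIn (𝓞 L) v.asIdeal)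
    (hH'w : IsUnit (placeForm H' w.1)) (hH'i : hH'w.unit ∈ glInt 3 (w.1.adicCompletion L))
    (hH'u : IsUnit H') (h2 : IsUnit (2 : 𝒪[w.1.adicCompletion L]))
    {γH : (cmDatum L 2 (Matrix.of fun i j : Fin 2 => if i.val + j.val + 1 = 2 then (1 : L) else 0)).Local v ×
      (cmDatum L 1 (Matrix.of fun i j : Fin 1 => if i.val + j.val + 1 = 1 then (1 : L) else 0)).Local v}
    (hreg : IsLocalGRegular L v γH)
    (hint : ∀ i : ℕ, ((((endoEmbLocal L v γH).val : GL (Fin 3) (LocalRing L v)).val.map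
        (Pi.evalRingHom (fun w' : PlacesOver L v => w'.1.adicCompletion L) w)).charpoly.coeff i) ∈ 𝒪[w.1.adicCompletion L])
    (hirr : ¬ ∃ x : w.1.adicCompletion L, (((γH.1.val : GL (Fin 2) (LocalRing L v)).val.map
        (Pi.evalRingHom (fun w' : PlacesOver L v => w'.1.adicCompletion L) w)).charpoly).IsRoot x)
    (n N : ℕ)
    (hn : Valued.v (((finCharpolyTwo L v γH).eval (finGammaTwo L v γH)) w) = WithZero.exp (-(n : ℤ)))
    (hN : Valued.v (((γH.1.val : GL (Fin 2) (LocalRing L v)).val.map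
        (Pi.evalRingHom (fun w' : PlacesOver L v => w'.1.adicCompletion L) w)).trace ^ 2 -
      4 * ((γH.1.val : GL (Fin 2) (LocalRing L v)).val.map
        (Pi.evalRingHom (fun w' : PlacesOver L v => w'.1.adicCompletion L) w)).det) = WithZero.exp (-((2 * N + 1 : ℕ) : ℤ)))
    (δ : (cmDatum L 3 H').Local v) (h : IsLocalNormPair L H' v γH δ) (hκ : finKappaAt L v H' γH δ = 1)
    (ht : ∀ m : ℕ, ValuativeRel.valuation (w.1.adicCompletion L)
      (((((δ.val : GL (Fin 3) (LocalRing L v)).val.map (Pi.evalRingHom (fun w' : UnitaryGroup.PlacesOver L v => w'.1.adicCompletion L) w))).charpoly -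
        (Polynomial.X - 1) ^ 3).coeff m) < 1) :
    (({q : (cmDatum L 3 H').Local v ⧸ cmLocalIntegralLevel L 3 H' v |
            q ∈ MulAction.fixedBy ((cmDatum L 3 H').Local v ⧸ cmLocalIntegralLevel L 3 H' v) δ ∧
              (redMat ((((q.out⁻¹ * δ * q.out : (cmDatum L 3 H').Local v)).val : GL (Fin 3) (LocalRing L v)).val.map
                (Pi.evalRingHom (fun w' : UnitaryGroup.PlacesOver L v => w'.1.adicCompletion L) w)) - 1).rank = 0}.ncard +
        {q : (cmDatum L 3 H').Local v ⧸ cmLocalIntegralLevel L 3 H' v |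
            q ∈ MulAction.fixedBy ((cmDatum L 3 H').Local v ⧸ cmLocalIntegralLevel L 3 H' v) δ ∧
              (redMat ((((q.out⁻¹ * δ * q.out : (cmDatum L 3 H').Local v)).val : GL (Fin 3) (LocalRing L v)).val.map
                (Pi.evalRingHom (fun w' : UnitaryGroup.PlacesOver L v => w'.1.adicCompletion L) w)) - 1).rank = 1}.ncard +
        {q : (cmDatum L 3 H').Local v ⧸ cmLocalIntegralLevel L 3 H' v |
            q ∈ MulAction.fixedBy ((cmDatum L 3 H').Local v ⧸ cmLocalIntegralLevel L 3 H' v) δ ∧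
              (redMat ((((q.out⁻¹ * δ * q.out : (cmDatum L 3 H').Local v)).val : GL (Fin 3) (LocalRing L v)).val.map
                (Pi.evalRingHom (fun w' : UnitaryGroup.PlacesOver L v => w'.1.adicCompletion L) w)) - 1).rank = 2}.ncard : ℕ) : ℚ) =
      Flicker1998.phiTHn (Ideal.absNorm v.asIdeal) n N := by
  classical
  -- Borel σ-algebras and a normalised Haar measure with a canonical family (the statement is measure-free)
  letI : MeasurableSpace ((cmDatum L 3 H').Local v) := borel _
  haveI : BorelSpace ((cmDatum L 3 H').Local v) := ⟨rfl⟩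
  letI : ∀ γ : ((cmDatum L 3 H').Local v), MeasurableSpace (((cmDatum L 3 H').Local v) ⧸ Subgroup.centralizer ({γ} : Set ((cmDatum L 3 H').Local v))) :=
    fun _ => borel _
  haveI : ∀ γ : ((cmDatum L 3 H').Local v), BorelSpace (((cmDatum L 3 H').Local v) ⧸ Subgroup.centralizer ({γ} : Set ((cmDatum L 3 H').Local v))) :=
    fun _ => ⟨rfl⟩
  obtain ⟨νG, _hHaar, _hright, hνG, mG, hmG⟩ := exists_haar_normalised_isCanonical L H' (v := v) hH' hH'u
  -- hermitian data in the `cmConjRingHom` spelling, regularity, compact centraliser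
  have hH'c : (H'.map (cmConjRingHom L))ᵀ = H' := by
    have e1 : H'.map (cmConjRingHom L) = H'.map (IsCMField.complexConj L) := by
      ext i j; simp [Matrix.map_apply, cmConjRingHom_apply]
    rw [e1]; exact hH'
  have hdet : H'.det ≠ 0 := (Matrix.isUnit_iff_isUnit_det _ |>.1 hH'u).ne_zero
  have hreg' : IsRegularElt (δ.val : GL (Fin 3) (LocalRing L v)) := isRegularElt_of_isLocalNormPair L H' v h hreg
  haveI : CompactSpace (Subgroup.centralizer ({δ} : Set ((cmDatum L 3 H').Local v))) :=
    compactSpace_centralizer_of_isLocalNormPair_of_not_exists_isRoot L v w hw hH'u hv hreg h2 hint hirr N hN δ h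
  -- the value `Φ(⟦δ⟧, 1_K) = phiTHn`
  have hval := classOrbitalIntegral_indicator_eq_phiTHn_of_finKappaAt_eq_one L H' hH' w hw hv hH'w hH'i νG hmG hνG hH'u h2 hreg hint hirr n N hn hN δ h hκ
  -- the strata formula for the constant piece `1_K`, `c ≡ 1`
  have hstr := classOrbitalIntegral_eq_mul_strata_three_of_deep L v w hw νG hH'c hdet hmG δ hreg' ht
    ((cmLocalIntegralLevel L 3 H' v : Set ((cmDatum L 3 H').Local v)).indicator fun _ => (1 : ℂ))
    (isLocSmooth_indicator_cmLocalIntegralLevel L 3 H' v) (tsupport_indicator_cmLocalIntegralLevel_subset L H')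
    (fun u hu x => indicator_cmLocalIntegralLevel_conj L H' u hu x) (fun _ => (1 : ℂ))
    (fun k hk _ => by rw [Set.indicator_of_mem (show (k : (cmDatum L 3 H').Local v) ∈ (cmLocalIntegralLevel L 3 H' v : Set _) from hk)])
  have hν1 : (νG.real (cmLocalIntegralLevel L 3 H' v : Set ((cmDatum L 3 H').Local v)) : ℂ) = 1 := by
    rw [measureReal_def, hνG, ENNReal.toReal_one, Complex.ofReal_one]
  rw [hval, hν1, one_mul, one_mul, one_mul, one_mul] at hstr
  exact_mod_cast hstr.symm

set_option maxHeartbeats 400000 in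
-- the strata sets are large terms (same budget as ★ p845914)
open scoped Classical in
/-- **THE `κ = −1` CLASS TOTAL**: the same with `κ_v(γ_H, δ) = −1` and `phiTHprimen q n N` (★ p842360 ED. 2). [cite: Flicker1998UnitaryFL, Prop. 17 p. 97; Thm. 18 p. 97]
[cite: Rogawski1990, §4.9 p. 54, Prop. 4.9.1 (b) p. 55] [cite: Kottwitz1986, §3] -/
theorem sum_ncard_rankStrata_eq_phiTHprimen_of_finKappaAt_eq_neg_one
    (hH' : (H'.map (IsCMField.complexConj L))ᵀ = H') (w : PlacesOver L v)
    (hw : IsCMField.complexConj L • w.1 = w.1) (hv : Algebra.IsUnramifiedIn (𝓞 L) v.asIdeal)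
    (hH'w : IsUnit (placeForm H' w.1)) (hH'i : hH'w.unit ∈ glInt 3 (w.1.adicCompletion L))
    (hH'u : IsUnit H') (h2 : IsUnit (2 : 𝒪[w.1.adicCompletion L]))
    {γH : (cmDatum L 2 (Matrix.of fun i j : Fin 2 => if i.val + j.val + 1 = 2 then (1 : L) else 0)).Local v ×
      (cmDatum L 1 (Matrix.of fun i j : Fin 1 => if i.val + j.val + 1 = 1 then (1 : L) else 0)).Local v}
    (hreg : IsLocalGRegular L v γH)
    (hint : ∀ i : ℕ, ((((endoEmbLocal L v γH).val : GL (Fin 3) (LocalRing L v)).val.map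
        (Pi.evalRingHom (fun w' : PlacesOver L v => w'.1.adicCompletion L) w)).charpoly.coeff i) ∈ 𝒪[w.1.adicCompletion L])
    (hirr : ¬ ∃ x : w.1.adicCompletion L, (((γH.1.val : GL (Fin 2) (LocalRing L v)).val.map
        (Pi.evalRingHom (fun w' : PlacesOver L v => w'.1.adicCompletion L) w)).charpoly).IsRoot x)
    (n N : ℕ)
    (hn : Valued.v (((finCharpolyTwo L v γH).eval (finGammaTwo L v γH)) w) = WithZero.exp (-(n : ℤ)))
    (hN : Valued.v (((γH.1.val : GL (Fin 2) (LocalRing L v)).val.map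
        (Pi.evalRingHom (fun w' : PlacesOver L v => w'.1.adicCompletion L) w)).trace ^ 2 -
      4 * ((γH.1.val : GL (Fin 2) (LocalRing L v)).val.map
        (Pi.evalRingHom (fun w' : PlacesOver L v => w'.1.adicCompletion L) w)).det) = WithZero.exp (-((2 * N + 1 : ℕ) : ℤ)))
    (δ : (cmDatum L 3 H').Local v) (h : IsLocalNormPair L H' v γH δ) (hκ : finKappaAt L v H' γH δ = -1)
    (ht : ∀ m : ℕ, ValuativeRel.valuation (w.1.adicCompletion L)
      (((((δ.val : GL (Fin 3) (LocalRing L v)).val.map (Pi.evalRingHom (fun w' : UnitaryGroup.PlacesOver L v => w'.1.adicCompletion L) w))).charpoly -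
        (Polynomial.X - 1) ^ 3).coeff m) < 1) :
    (({q : (cmDatum L 3 H').Local v ⧸ cmLocalIntegralLevel L 3 H' v |
            q ∈ MulAction.fixedBy ((cmDatum L 3 H').Local v ⧸ cmLocalIntegralLevel L 3 H' v) δ ∧
              (redMat ((((q.out⁻¹ * δ * q.out : (cmDatum L 3 H').Local v)).val : GL (Fin 3) (LocalRing L v)).val.map
                (Pi.evalRingHom (fun w' : UnitaryGroup.PlacesOver L v => w'.1.adicCompletion L) w)) - 1).rank = 0}.ncard +
        {q : (cmDatum L 3 H').Local v ⧸ cmLocalIntegralLevel L 3 H' v |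
            q ∈ MulAction.fixedBy ((cmDatum L 3 H').Local v ⧸ cmLocalIntegralLevel L 3 H' v) δ ∧
              (redMat ((((q.out⁻¹ * δ * q.out : (cmDatum L 3 H').Local v)).val : GL (Fin 3) (LocalRing L v)).val.map
                (Pi.evalRingHom (fun w' : UnitaryGroup.PlacesOver L v => w'.1.adicCompletion L) w)) - 1).rank = 1}.ncard +
        {q : (cmDatum L 3 H').Local v ⧸ cmLocalIntegralLevel L 3 H' v |
            q ∈ MulAction.fixedBy ((cmDatum L 3 H').Local v ⧸ cmLocalIntegralLevel L 3 H' v) δ ∧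
              (redMat ((((q.out⁻¹ * δ * q.out : (cmDatum L 3 H').Local v)).val : GL (Fin 3) (LocalRing L v)).val.map
                (Pi.evalRingHom (fun w' : UnitaryGroup.PlacesOver L v => w'.1.adicCompletion L) w)) - 1).rank = 2}.ncard : ℕ) : ℚ) =
      Flicker1998.phiTHprimen (Ideal.absNorm v.asIdeal) n N := by
  classical
  -- Borel σ-algebras and a normalised Haar measure with a canonical family (the statement is measure-free)
  letI : MeasurableSpace ((cmDatum L 3 H').Local v) := borel _
  haveI : BorelSpace ((cmDatum L 3 H').Local v) := ⟨rfl⟩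
  letI : ∀ γ : ((cmDatum L 3 H').Local v), MeasurableSpace (((cmDatum L 3 H').Local v) ⧸ Subgroup.centralizer ({γ} : Set ((cmDatum L 3 H').Local v))) :=
    fun _ => borel _
  haveI : ∀ γ : ((cmDatum L 3 H').Local v), BorelSpace (((cmDatum L 3 H').Local v) ⧸ Subgroup.centralizer ({γ} : Set ((cmDatum L 3 H').Local v))) :=
    fun _ => ⟨rfl⟩
  obtain ⟨νG, _hHaar, _hright, hνG, mG, hmG⟩ := exists_haar_normalised_isCanonical L H' (v := v) hH' hH'u
  have hH'c : (H'.map (cmConjRingHom L))ᵀ = H' := by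
    have e1 : H'.map (cmConjRingHom L) = H'.map (IsCMField.complexConj L) := by
      ext i j; simp [Matrix.map_apply, cmConjRingHom_apply]
    rw [e1]; exact hH'
  have hdet : H'.det ≠ 0 := (Matrix.isUnit_iff_isUnit_det _ |>.1 hH'u).ne_zero
  have hreg' : IsRegularElt (δ.val : GL (Fin 3) (LocalRing L v)) := isRegularElt_of_isLocalNormPair L H' v h hreg
  haveI : CompactSpace (Subgroup.centralizer ({δ} : Set ((cmDatum L 3 H').Local v))) :=
    compactSpace_centralizer_of_isLocalNormPair_of_not_exists_isRoot L v w hw hH'u hv hreg h2 hint hirr N hN δ h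
  have hval := classOrbitalIntegral_indicator_eq_phiTHprimen_of_finKappaAt_eq_neg_one' L H' hH' hH'u w hw hv hH'w hH'i νG hmG hνG h2 hreg hint n N hn hN δ h hκ
  have hstr := classOrbitalIntegral_eq_mul_strata_three_of_deep L v w hw νG hH'c hdet hmG δ hreg' ht
    ((cmLocalIntegralLevel L 3 H' v : Set ((cmDatum L 3 H').Local v)).indicator fun _ => (1 : ℂ))
    (isLocSmooth_indicator_cmLocalIntegralLevel L 3 H' v) (tsupport_indicator_cmLocalIntegralLevel_subset L H')
    (fun u hu x => indicator_cmLocalIntegralLevel_conj L H' u hu x) (fun _ => (1 : ℂ))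
    (fun k hk _ => by rw [Set.indicator_of_mem (show (k : (cmDatum L 3 H').Local v) ∈ (cmLocalIntegralLevel L 3 H' v : Set _) from hk)])
  have hν1 : (νG.real (cmLocalIntegralLevel L 3 H' v : Set ((cmDatum L 3 H').Local v)) : ℂ) = 1 := by
    rw [measureReal_def, hνG, ENNReal.toReal_one, Complex.ofReal_one]
  rw [hval, hν1, one_mul, one_mul, one_mul, one_mul] at hstr
  exact_mod_cast hstr.symm

/-! ## §3 THE UNIT ROW -/

set_option maxHeartbeats 400000 in
-- the strata sets are large terms (same budget as ★ p845914)
open scoped Classical in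
/-- **THE UNIT ROW OF THE TYPE-(2) SOCKET** (`hK` of ★ `finsum_finExplicitDelta_mul_classOrbitalIntegral_eq_of_irreducible_of_strata` with `np := n(δ₊)`, `nm := n(δ₋)`): for deep
matches `δ₊`, `δ₋` of a `G`-regular type-(2) `γ_H` with `κ_v(γ_H, δ_±) = ±1` and the exponent law `n ≤ 2N+1`, `n` even or `n = 2N+1`,
`Σ_r n_r(δ₊) − Σ_r n_r(δ₋) = (−q)^n · phiHtwo q N` — Flicker's Theorem 18 read on the strata totals. [cite: Flicker1998UnitaryFL, Thm. 18 p. 97]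
[cite: Rogawski1990, §4.9 Prop. 4.9.1 (b) p. 55] -/
theorem sum_ncard_rankStrata_sub_eq_neg_pow_mul_phiHtwo
    (hH' : (H'.map (IsCMField.complexConj L))ᵀ = H') (w : PlacesOver L v)
    (hw : IsCMField.complexConj L • w.1 = w.1) (hv : Algebra.IsUnramifiedIn (𝓞 L) v.asIdeal)
    (hH'w : IsUnit (placeForm H' w.1)) (hH'i : hH'w.unit ∈ glInt 3 (w.1.adicCompletion L))
    (hH'u : IsUnit H') (h2 : IsUnit (2 : 𝒪[w.1.adicCompletion L]))
    {γH : (cmDatum L 2 (Matrix.of fun i j : Fin 2 => if i.val + j.val + 1 = 2 then (1 : L) else 0)).Local v ×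
      (cmDatum L 1 (Matrix.of fun i j : Fin 1 => if i.val + j.val + 1 = 1 then (1 : L) else 0)).Local v}
    (hreg : IsLocalGRegular L v γH)
    (hint : ∀ i : ℕ, ((((endoEmbLocal L v γH).val : GL (Fin 3) (LocalRing L v)).val.map
        (Pi.evalRingHom (fun w' : PlacesOver L v => w'.1.adicCompletion L) w)).charpoly.coeff i) ∈ 𝒪[w.1.adicCompletion L])
    (hirr : ¬ ∃ x : w.1.adicCompletion L, (((γH.1.val : GL (Fin 2) (LocalRing L v)).val.map
        (Pi.evalRingHom (fun w' : PlacesOver L v => w'.1.adicCompletion L) w)).charpoly).IsRoot x)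
    (n N : ℕ)
    (hn : Valued.v (((finCharpolyTwo L v γH).eval (finGammaTwo L v γH)) w) = WithZero.exp (-(n : ℤ)))
    (hN : Valued.v (((γH.1.val : GL (Fin 2) (LocalRing L v)).val.map
        (Pi.evalRingHom (fun w' : PlacesOver L v => w'.1.adicCompletion L) w)).trace ^ 2 -
      4 * ((γH.1.val : GL (Fin 2) (LocalRing L v)).val.map
        (Pi.evalRingHom (fun w' : PlacesOver L v => w'.1.adicCompletion L) w)).det) = WithZero.exp (-((2 * N + 1 : ℕ) : ℤ)))
    (hnN : n ≤ 2 * N + 1) (hpar : Even n ∨ n = 2 * N + 1) (hq : 1 < Ideal.absNorm v.asIdeal)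
    (δp : (cmDatum L 3 H').Local v) (hp : IsLocalNormPair L H' v γH δp) (hκp : finKappaAt L v H' γH δp = 1)
    (htp : ∀ m : ℕ, ValuativeRel.valuation (w.1.adicCompletion L)
      (((((δp.val : GL (Fin 3) (LocalRing L v)).val.map (Pi.evalRingHom (fun w' : UnitaryGroup.PlacesOver L v => w'.1.adicCompletion L) w))).charpoly -
        (Polynomial.X - 1) ^ 3).coeff m) < 1)
    (δm : (cmDatum L 3 H').Local v) (hm : IsLocalNormPair L H' v γH δm) (hκm : finKappaAt L v H' γH δm = -1)
    (htm : ∀ m : ℕ, ValuativeRel.valuation (w.1.adicCompletion L)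
      (((((δm.val : GL (Fin 3) (LocalRing L v)).val.map (Pi.evalRingHom (fun w' : UnitaryGroup.PlacesOver L v => w'.1.adicCompletion L) w))).charpoly -
        (Polynomial.X - 1) ^ 3).coeff m) < 1) :
    (({q : (cmDatum L 3 H').Local v ⧸ cmLocalIntegralLevel L 3 H' v |
            q ∈ MulAction.fixedBy ((cmDatum L 3 H').Local v ⧸ cmLocalIntegralLevel L 3 H' v) δp ∧
              (redMat ((((q.out⁻¹ * δp * q.out : (cmDatum L 3 H').Local v)).val : GL (Fin 3) (LocalRing L v)).val.map
                (Pi.evalRingHom (fun w' : UnitaryGroup.PlacesOver L v => w'.1.adicCompletion L) w)) - 1).rank = 0}.ncard +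
        {q : (cmDatum L 3 H').Local v ⧸ cmLocalIntegralLevel L 3 H' v |
            q ∈ MulAction.fixedBy ((cmDatum L 3 H').Local v ⧸ cmLocalIntegralLevel L 3 H' v) δp ∧
              (redMat ((((q.out⁻¹ * δp * q.out : (cmDatum L 3 H').Local v)).val : GL (Fin 3) (LocalRing L v)).val.map
                (Pi.evalRingHom (fun w' : UnitaryGroup.PlacesOver L v => w'.1.adicCompletion L) w)) - 1).rank = 1}.ncard +
        {q : (cmDatum L 3 H').Local v ⧸ cmLocalIntegralLevel L 3 H' v |
            q ∈ MulAction.fixedBy ((cmDatum L 3 H').Local v ⧸ cmLocalIntegralLevel L 3 H' v) δp ∧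
              (redMat ((((q.out⁻¹ * δp * q.out : (cmDatum L 3 H').Local v)).val : GL (Fin 3) (LocalRing L v)).val.map
                (Pi.evalRingHom (fun w' : UnitaryGroup.PlacesOver L v => w'.1.adicCompletion L) w)) - 1).rank = 2}.ncard : ℕ) : ℚ) -
      (({q : (cmDatum L 3 H').Local v ⧸ cmLocalIntegralLevel L 3 H' v |
            q ∈ MulAction.fixedBy ((cmDatum L 3 H').Local v ⧸ cmLocalIntegralLevel L 3 H' v) δm ∧
              (redMat ((((q.out⁻¹ * δm * q.out : (cmDatum L 3 H').Local v)).val : GL (Fin 3) (LocalRing L v)).val.map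
                (Pi.evalRingHom (fun w' : UnitaryGroup.PlacesOver L v => w'.1.adicCompletion L) w)) - 1).rank = 0}.ncard +
        {q : (cmDatum L 3 H').Local v ⧸ cmLocalIntegralLevel L 3 H' v |
            q ∈ MulAction.fixedBy ((cmDatum L 3 H').Local v ⧸ cmLocalIntegralLevel L 3 H' v) δm ∧
              (redMat ((((q.out⁻¹ * δm * q.out : (cmDatum L 3 H').Local v)).val : GL (Fin 3) (LocalRing L v)).val.map
                (Pi.evalRingHom (fun w' : UnitaryGroup.PlacesOver L v => w'.1.adicCompletion L) w)) - 1).rank = 1}.ncard +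
        {q : (cmDatum L 3 H').Local v ⧸ cmLocalIntegralLevel L 3 H' v |
            q ∈ MulAction.fixedBy ((cmDatum L 3 H').Local v ⧸ cmLocalIntegralLevel L 3 H' v) δm ∧
              (redMat ((((q.out⁻¹ * δm * q.out : (cmDatum L 3 H').Local v)).val : GL (Fin 3) (LocalRing L v)).val.map
                (Pi.evalRingHom (fun w' : UnitaryGroup.PlacesOver L v => w'.1.adicCompletion L) w)) - 1).rank = 2}.ncard : ℕ) : ℚ) =
      (-(Ideal.absNorm v.asIdeal : ℚ)) ^ n * Flicker1998.phiHtwo (Ideal.absNorm v.asIdeal) N := by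
  rw [sum_ncard_rankStrata_eq_phiTHn_of_finKappaAt_eq_one L H' hH' w hw hv hH'w hH'i hH'u h2 hreg hint hirr n N hn hN δp hp hκp htp,
    sum_ncard_rankStrata_eq_phiTHprimen_of_finKappaAt_eq_neg_one L H' hH' w hw hv hH'w hH'i hH'u h2 hreg hint hirr n N hn hN δm hm hκm htm]
  exact Flicker1998.flicker_theorem18n hq hnN hpar

end Literature.NumberTheory.Rogawski1990

end
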